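import Summits.ResolutionOfSingularities.ResolutionOfSingularities.Theorems.PurelyInseparableDim4ResConeTwoSlotLegality
import Summits.ResolutionOfSingularities.ResolutionOfSingularities.Theorems.PurelyInseparableDim4ResConeCornerWalls
import Summits.ResolutionOfSingularities.ResolutionOfSingularities.Theorems.PurelyInseparableDim4ResConeShadeTwoCorner
import HarnessLib
import HarnessLib.Audit.Tags

/-!
# Purely inseparable four-folds — the C∞ GAME READ IN THE FRAME (K24b-F3): LEGALITY and FLAG readings of a pure
# corner step at `p = 5`, `d = 4`, in uniform exponent form (cell `res-dim4-pi`, K2(p) lane, slice B)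

[OURS · counted 0 · cell `res-dim4-pi` · K2(p) lane holder res-dim4-p-12 g3's brick «p-3 takes K24b-F3 FLAG /
LEGALITY READINGS» by signature (bus 2026-08-29 03:02Z); the `d = 4` analogue of res-dim4-p-1 g3's K24a-β5/β6
(`…ResConeTwoSlotLegality`, `…ResConeTwoSlotFlag`); game encoding res-dim4-p-9 g3 (`…ResConeCInfGame`,
`…ResConeCInfGameExact`); seat res-dim4-p-3 g3.]  Nothing here proves K2(p)/K2(5), `NoIsolatedTrap p p` or
resolution of singularities in dimension ≥ 4 / characteristic `p`.  AI kernel work, weaker than expert review.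

SETTING (`p = 5`, `d = 4`, the C∞ regime read at ONE state, fixed letters): a state `s = (F, r, exc)` with
boundary `r = e_κ + e_o` (the chart letter `κ ∈ {λ, μ}` and the other boundary letter `o`, both of weight `1`),
`x^r ∣ F`, `ord₀ F = 6`, STRAIGHT at the free letter `f` (the residual's degree-`4` part is `a·x_f⁴`:
`coeff_{r+4e_f} F ≠ 0` and every other `coeff_{r+m̃} F`, `|m̃| = 4`, vanishes) with the Tschirnhaus row
`coeff_{r+3e_f+2e_κ} F = 0`; the PURE CORNER child in chart `κ` is `s′ := CentreBlowup.step 5 univ κ 0 s`.  Residual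
exponents `m̃` are res-dim4-p-9's game monomials `(c, a, b, e)` through res-dim4-p-2 g4's dictionary
`m̃ = (a+1)e_λ + (b+1)e_μ + e·e_u + (3−c)e_f` (F2); everything below is stated on `m̃`, so no dictionary is needed here.

* §1 cone algebra at `d = 4`: a power cone `c·L⁴` containing `x_f⁴` and no `x_f³x_i` is `c ℓ_f⁴·x_f⁴`
  (`linearForm_off_eq_zero_four`, `coeff_powerCone_eq_zero_of_straight_four`; `4 ≠ 0` in `K`).
* §2 exponent bookkeeping: the chart law on `r + m̃` for `|r| = 2` (`chartExponent_pair_add`: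
  `m̃ ↦ m̃.update κ (|m̃| − 4)` — the game's `a ↦ a + b + e − c`); `degree_update_add` is imported from
  `…ResConeShadeTwoCorner`.
* §3 **`cInf_legal_readings_of_corner`** (LEG): if the child again has `ord₀ = 6` and `e_G = 3` then (i) the child
  is STRAIGHT again in the transported frame, (ii) `coeff_{r+4e_f}` is carried identically, (iii) LEGAL(κ): every
  parent residual monomial `m̃ ≠ 4e_f` with `4 ≤ |m̃|` and `2|m̃| ≤ m̃_κ + 8` is absent — for `κ = λ` and
  `m̃ = (a+1, b+1, e, 3−c)` this is `a + 2b + 2e + 1 ≤ 2c`, i.e. «no λ-BLOCKER is present», the game's `hlegL`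
  verbatim (only residual degrees `≤ 8` are read).
* §4 **`cInf_flag_reading`** (FLAG): isolation of a state with `r_l = 1`, `|r| = 2` gives a monomial `x^{r+m̃}` with
  `|m̃| ≤ m̃_l + 3` — for `l = λ` this is `b + e + 1 ≤ c`, the game's λ-FLAG (`hflagL`); p-5's
  `ordAlong_erase_lt_of_isIsolated` along the `l`-axis.  CAVEAT (design ruling (iii), holder 02:51Z): the
  witness's `l`-exponent is NOT bounded here — isolation alone allows a far witness `x_l^N·(near-axis part)`;
  confining it to the window is F2's / res-dim4-idea-4's (d).

[cite: CossartJannsenSaito2020, Thm. 3.14] [cite: HauserPerlega2019PRIMS, §2 (the blowup in the x₁-chart)]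
bears_on: LADDER-RESOLUTION:D157-DOOR2 (res-dim4-pi · K2(p) · slice B · K24b-F3).  Supports
stmt-ResolutionOfSingularities-16155 (helper).
-/

set_option linter.dupNamespace false -- mandated namespace of this single-conjunct summit

noncomputable section

namespace Summit.ResolutionOfSingularities.ResolutionOfSingularities.Theorems.PIDim4

namespace ResCone

open MvPolynomial Finset
open Literature.AlgebraicGeometry.Resolution
open Literature.AlgebraicGeometry.Resolution.CentreBlowup
open Literature.AlgebraicGeometry.Resolution.Hauser2010
open Literature.AlgebraicGeometry.Resolution.HauserPerlega2019

variable {K : Type} [Field K]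

/-! ## 1. A straight power cone of degree `4` -/

/-- **A power cone `c·L⁴` that contains `x_f⁴` and no `x_f³·x_i` is a pure fourth power of `x_f`**: `ℓ_i = 0` for
`i ≠ f` (`coeff_{x_f⁴} = c ℓ_f⁴ ≠ 0`, `coeff_{x_f³x_i} = 4 c ℓ_f³ ℓ_i`; needs `4 ≠ 0` in `K`). [folklore] -/
theorem linearForm_off_eq_zero_four {ℓ : Fin 4 → K} {c : K} (f : Fin 4) (h4 : (4 : K) ≠ 0)
    (hc : coeff (Finsupp.single f 4) (C c * (∑ i, C (ℓ i) * X i) ^ 4) ≠ 0)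
    (h0 : ∀ i, i ≠ f → coeff (Finsupp.single i 1 + Finsupp.single f 3) (C c * (∑ i, C (ℓ i) * X i) ^ 4) = 0) :
    ∀ i, i ≠ f → ℓ i = 0 := by
  intro i hi
  rw [coeff_C_mul, coeff_single_linearFormSum_pow] at hc
  have h := h0 i hi
  have key : coeff (Finsupp.single i 1 + Finsupp.single f 3) ((∑ i, C (ℓ i) * X i : MvPolynomial (Fin 4) K) ^ 4)
      = (3 + 1 : K) * ℓ f ^ 3 * ℓ i := coeff_single_add_single_linearFormSum_pow hi ℓ 3
  rw [coeff_C_mul, key] at h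
  have hcℓ : c ≠ 0 ∧ ℓ f ≠ 0 := by
    refine ⟨fun h0c => hc (by rw [h0c, zero_mul]), fun h0ℓ => hc (by rw [h0ℓ]; ring)⟩
  have h4' : (3 + 1 : K) ≠ 0 := by rw [show (3 + 1 : K) = 4 by norm_num]; exact h4
  rcases mul_eq_zero.mp h with h1 | h1
  · exact absurd h1 hcℓ.1
  · rcases mul_eq_zero.mp h1 with h2 | h2
    · rcases mul_eq_zero.mp h2 with h5 | h5
      · exact absurd h5 h4'
      · exact absurd (pow_eq_zero_iff (by norm_num) |>.mp h5) hcℓ.2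
    · exact h2

/-- **All degree-`4` coefficients of a straight power cone other than `x_f⁴` vanish.** [folklore] -/
theorem coeff_powerCone_eq_zero_of_straight_four {ℓ : Fin 4 → K} {c : K} (f : Fin 4) (h4 : (4 : K) ≠ 0)
    (hc : coeff (Finsupp.single f 4) (C c * (∑ i, C (ℓ i) * X i) ^ 4) ≠ 0)
    (h0 : ∀ i, i ≠ f → coeff (Finsupp.single i 1 + Finsupp.single f 3) (C c * (∑ i, C (ℓ i) * X i) ^ 4) = 0)
    {m : Fin 4 →₀ ℕ} (hm : m ≠ Finsupp.single f 4) :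
    coeff m (C c * (∑ i, C (ℓ i) * X i) ^ 4) = 0 := by
  classical
  have hoff := linearForm_off_eq_zero_four f h4 hc h0
  have hL : (∑ i, C (ℓ i) * X i : MvPolynomial (Fin 4) K) = C (ℓ f) * X f := by
    rw [← Finset.add_sum_erase _ _ (Finset.mem_univ f)]
    rw [Finset.sum_eq_zero fun i hi => by rw [hoff i (Finset.ne_of_mem_erase hi), C_0, zero_mul], add_zero]
  rw [hL, mul_pow, ← map_pow, ← mul_assoc, ← map_mul, X_pow_eq_monomial, C_mul_monomial, coeff_monomial,
    if_neg (Ne.symm hm)]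

/-! ## 2. Exponent bookkeeping for a boundary of two letters of weight `1` -/

/-- **The chart image of a residual monomial** over the boundary `r = e_κ + e_o`: for `|m̃| ≥ 4`,
`chartExponent 5 univ κ (r + m̃) = r + m̃.update κ (|m̃| − 4)` — the game's `(c, a, b, e) ↦ (c, a + b + e − c, b, e)`.
[folklore] -/
theorem chartExponent_pair_add {κ o : Fin 4} (hκo : κ ≠ o) {r m : Fin 4 →₀ ℕ}
    (hr : r = Finsupp.single κ 1 + Finsupp.single o 1) (hm : 4 ≤ m.degree) :
    chartExponent 5 Finset.univ κ (r + m) = r + m.update κ (m.degree - 4) := by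
  have hrκ : r κ = 1 := by rw [hr]; simp [hκo]
  have hrdeg : r.degree = 2 := by rw [hr, map_add]; simp
  rw [chartExponent_univ_eq_update]
  ext k
  by_cases hk : k = κ
  · rw [hk, Finsupp.coe_update, Function.update_self, Finsupp.add_apply, Finsupp.coe_update,
      Function.update_self, map_add, hrdeg, hrκ]
    omega
  · rw [Finsupp.coe_update, Function.update_of_ne hk, Finsupp.add_apply, Finsupp.add_apply,
      Finsupp.coe_update, Function.update_of_ne hk]

-- `degree_update_add : |m̃.update κ v| + m̃_κ = |m̃| + v` is res-dim4-p-7's (`…ResConeShadeTwoCorner`, imported).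

/-- An exponent of degree `4` taking the value `4` at `f` is `4e_f`. [folklore] -/
theorem eq_single_of_degree_eq_of_apply_eq {m : Fin 4 →₀ ℕ} {f : Fin 4} {n : ℕ} (hdeg : m.degree = n)
    (hf : m f = n) : m = Finsupp.single f n := by
  have hle : Finsupp.single f n ≤ m := Finsupp.single_le_iff.mpr (by rw [hf])
  have h := degree_sub_add_degree hle
  rw [hdeg, Finsupp.degree_single] at h
  have h0 : (m - Finsupp.single f n).degree = 0 := by omega
  rw [Finsupp.degree_eq_zero_iff] at h0
  have := tsub_add_cancel_of_le hle
  rw [h0, zero_add] at this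
  exact this.symm

/-! ## 3. LEGALITY of a pure corner step, read in the frame (`d = 4`) -/

section Legal

variable [CharP K 5] [DecidableEq K]

/-- **THE TRANSPORTED FRAME STRAIGHTENS THE CHILD, and LEGALITY** (K24b-F3, `p = 5`, `d = 4`).  Pure corner step
in chart `κ` of a state with boundary `r = e_κ + e_o` (weights `1`), `x^r ∣ F`, `ord₀ F = 6`, STRAIGHT at the free
letter `f` (`coeff_{r+4e_f} F ≠ 0`, every other degree-`4` residual coefficient vanishes) with the Tschirnhaus row
`coeff_{r+3e_f+2e_κ} F = 0`; if the child `s′` has `ord₀ = 6` and `e_G = 3` then: (i) the child is straight again —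
every degree-`4` residual coefficient of `s′` other than `x_f⁴` vanishes; (ii) `coeff_{r+4e_f}` is carried
identically; (iii) LEGAL(κ): every parent residual monomial `m̃ ≠ 4e_f` with `4 ≤ |m̃|` and `2|m̃| ≤ m̃_κ + 8`
(its chart image has residual degree `≤ 4`) is absent — «no κ-BLOCKER present», res-dim4-p-9's `hlegL`/`hlegM`.
[OURS · idea-4's LEGAL table, uniform form] [cite: CossartJannsenSaito2020, Thm. 3.14] -/
theorem cInf_legal_readings_of_corner {κ o f : Fin 4} (hκo : κ ≠ o) (hκf : κ ≠ f) (hof : o ≠ f) {s : State K}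
    (hr : s.r = Finsupp.single κ 1 + Finsupp.single o 1)
    (hdiv : ∀ e ∈ s.F.support, s.r ≤ e) (ho : ordZero s.F = (6 : ℕ))
    (ha : coeff (s.r + Finsupp.single f 4) s.F ≠ 0)
    (hstraight : ∀ m : Fin 4 →₀ ℕ, m.degree = 4 → m ≠ Finsupp.single f 4 → coeff (s.r + m) s.F = 0)
    (htsch : coeff (s.r + (Finsupp.single f 3 + Finsupp.single κ 2)) s.F = 0)
    (ho' : ordZero (CentreBlowup.step 5 Finset.univ κ 0 s).F = (6 : ℕ))
    (he3' : Module.finrank K (resVertex (CentreBlowup.step 5 Finset.univ κ 0 s)) = 3) :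
    (∀ m : Fin 4 →₀ ℕ, m.degree = 4 → m ≠ Finsupp.single f 4 →
        coeff (s.r + m) (CentreBlowup.step 5 Finset.univ κ 0 s).F = 0) ∧
      coeff (s.r + Finsupp.single f 4) (CentreBlowup.step 5 Finset.univ κ 0 s).F =
        coeff (s.r + Finsupp.single f 4) s.F ∧
      ∀ m : Fin 4 →₀ ℕ, 4 ≤ m.degree → 2 * m.degree ≤ m κ + 8 → m ≠ Finsupp.single f 4 →
        coeff (s.r + m) s.F = 0 := by
  haveI : Fact (Nat.Prime 5) := ⟨by norm_num⟩
  have h4 : (4 : K) ≠ 0 := fun h =>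
    absurd ((CharP.cast_eq_zero_iff K 5 4).mp (by exact_mod_cast h)) (by norm_num)
  set s' := CentreBlowup.step 5 Finset.univ κ 0 s with hs'
  have hrκ : s.r κ = 1 := by rw [hr]; simp [hκo]
  have hro : s.r o = 1 := by rw [hr]; simp [hκo.symm]
  have hr' : s'.r = s.r := step_zero_r_eq ho hdiv hrκ
  have hrdeg : s.r.degree = 2 := by rw [hr, map_add]; simp
  have hdiv' : ∀ e ∈ s'.F.support, s'.r ≤ e :=
    newMult_le_of_mem_support_step 5 Finset.univ κ 0 rfl s ho hdiv (perm_univ ho hdiv)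
  have hq : ((5 : ℕ) : ℕ∞) ≤ ordAlong Finset.univ s.F := by
    rw [ordAlong_univ, ho]; exact_mod_cast (by norm_num : 5 ≤ 6)
  -- the chart law at residual monomials `r + m̃`, `|m̃| ≥ 4`, `m̃ o ≤ 3` (so the image is no 5-th power)
  have hchart : ∀ m : Fin 4 →₀ ℕ, 4 ≤ m.degree → m o ≤ 3 →
      coeff (s.r + m.update κ (m.degree - 4)) s'.F = coeff (s.r + m) s.F := by
    intro m hm hmo
    rw [← chartExponent_pair_add hκo hr hm, coeff_step_zero_chartExponent 5 κ s hq
      (by rw [map_add, hrdeg]; omega), if_neg (not_isPthPowerExponent_of_not_dvd (i := o) ?_)]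
    rw [chartExponent_pair_add hκo hr hm, Finsupp.add_apply, hro, Finsupp.coe_update,
      Function.update_of_ne hκo.symm]
    omega
  -- the child's residual cone and how to read the child at degree 6
  obtain ⟨ℓ', c, -, -, hform⟩ := resForm_eq_C_mul_pow_of_finrank_eq_three 5 ho'
    (by rw [hr', hrdeg]; norm_num) he3'
  rw [hr', hrdeg, show 6 - 2 = 4 from rfl] at hform
  have hread : ∀ m : Fin 4 →₀ ℕ, m.degree = 4 →
      coeff (s.r + m) s'.F = coeff m (C c * (∑ i, C (ℓ' i) * X i) ^ 4) := by
    intro m hm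
    have h := congrArg (coeff (s.r + m)) (monomial_mul_resForm hdiv')
    rw [hr', coeff_monomial_mul', if_pos le_self_add, one_mul, add_tsub_cancel_left, hform] at h
    rw [h]
    unfold initialForm
    rw [ho', ENat.toNat_coe, coeff_homogeneousComponent, if_pos (by rw [map_add, hrdeg, hm])]
  -- (i) the child is straight: no `x_f³ x_i`
  have hchild_straight : ∀ i, i ≠ f →
      coeff (Finsupp.single i 1 + Finsupp.single f 3) (C c * (∑ i, C (ℓ' i) * X i) ^ 4) = 0 := by
    intro i hi
    have hdeg4 : (Finsupp.single i 1 + Finsupp.single f 3 : Fin 4 →₀ ℕ).degree = 4 := by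
      rw [map_add, Finsupp.degree_single, Finsupp.degree_single]
    rw [← hread _ hdeg4]
    by_cases hiκ : i = κ
    · -- preimage: the Tschirnhaus monomial `r + 3e_f + 2e_κ`
      subst hiκ
      have h := hchart (Finsupp.single f 3 + Finsupp.single i 2) (by
        rw [map_add, Finsupp.degree_single, Finsupp.degree_single]; norm_num) (by
        simp [hof, hκo.symm])
      have hupd : (Finsupp.single f 3 + Finsupp.single i 2 : Fin 4 →₀ ℕ).update i
          ((Finsupp.single f 3 + Finsupp.single i 2 : Fin 4 →₀ ℕ).degree - 4) =
          Finsupp.single i 1 + Finsupp.single f 3 := by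
        rw [map_add, Finsupp.degree_single, Finsupp.degree_single]
        ext k; by_cases hk : k = i
        · subst hk; simp [hκf.symm]
        · simp [Finsupp.coe_update, Function.update_of_ne hk, Finsupp.single_apply, Ne.symm hk]
      rw [hupd] at h
      rw [h]; exact htsch
    · -- preimage: `r + 3e_f + e_i` itself (its `κ`-exponent is `0`, its image has the same exponent)
      have h := hchart (Finsupp.single f 3 + Finsupp.single i 1) (by
        rw [map_add, Finsupp.degree_single, Finsupp.degree_single]) (by
        simp only [Finsupp.add_apply, Finsupp.single_apply, if_neg hof.symm, zero_add]
        split_ifs <;> omega)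
      have hupd : (Finsupp.single f 3 + Finsupp.single i 1 : Fin 4 →₀ ℕ).update κ
          ((Finsupp.single f 3 + Finsupp.single i 1 : Fin 4 →₀ ℕ).degree - 4) =
          Finsupp.single i 1 + Finsupp.single f 3 := by
        rw [map_add, Finsupp.degree_single, Finsupp.degree_single]
        ext k; by_cases hk : k = κ
        · subst hk; simp [hκf, Ne.symm hiκ]
        · simp [Finsupp.coe_update, Function.update_of_ne hk, Finsupp.single_apply]
          ring
      rw [hupd] at h
      rw [h]
      refine hstraight _ (by rw [map_add, Finsupp.degree_single, Finsupp.degree_single]) fun heq => hi ?_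
      have := DFunLike.congr_fun heq i
      simp [Ne.symm hi] at this
  -- (ii) the `x_f⁴` coefficient is carried (`r + 4e_f` is fixed by the chart law)
  have hx4 : coeff (s.r + Finsupp.single f 4) s'.F = coeff (s.r + Finsupp.single f 4) s.F := by
    have h := hchart (Finsupp.single f 4) (by rw [Finsupp.degree_single]) (by
      simp [hof])
    have hupd : (Finsupp.single f 4 : Fin 4 →₀ ℕ).update κ ((Finsupp.single f 4 : Fin 4 →₀ ℕ).degree - 4) =
        Finsupp.single f 4 := by
      rw [Finsupp.degree_single, Nat.sub_self]
      ext k; by_cases hk : k = κ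
      · subst hk; simp [hκf.symm]
      · simp [Finsupp.coe_update, Function.update_of_ne hk]
    rwa [hupd] at h
  have hc4 : coeff (Finsupp.single f 4) (C c * (∑ i, C (ℓ' i) * X i) ^ 4) ≠ 0 := by
    rw [← hread _ (Finsupp.degree_single f 4), hx4]; exact ha
  -- (i) every other degree-4 residual coefficient of the child vanishes
  have hzero : ∀ m : Fin 4 →₀ ℕ, m.degree = 4 → m ≠ Finsupp.single f 4 → coeff (s.r + m) s'.F = 0 :=
    fun m hm hne => by
      rw [hread m hm]; exact coeff_powerCone_eq_zero_of_straight_four f h4 hc4 hchild_straight hne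
  refine ⟨hzero, hx4, fun m hm4 hle hne => ?_⟩
  -- (iii) LEGAL(κ): the image of `m̃` has residual degree `≤ 4`
  have hdeg' := degree_update_add m κ (m.degree - 4)
  by_cases hmo : m o ≤ 3
  · rw [← hchart m hm4 hmo]
    by_cases h4' : (m.update κ (m.degree - 4)).degree = 4
    · refine hzero _ h4' fun heq => hne ?_
      -- `m̃.update κ (|m̃| − 4) = 4e_f` forces `|m̃| = 4`, `m̃ f = 4`, hence `m̃ = 4e_f`
      have hκ0 : m.degree - 4 = 0 := by
        have := DFunLike.congr_fun heq κ
        rw [Finsupp.coe_update, Function.update_self, Finsupp.single_apply, if_neg (Ne.symm hκf)] at this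
        exact this
      have hmf : m f = 4 := by
        have := DFunLike.congr_fun heq f
        rw [Finsupp.coe_update, Function.update_of_ne (Ne.symm hκf), Finsupp.single_eq_same] at this
        exact this
      exact eq_single_of_degree_eq_of_apply_eq (by omega) hmf
    · refine coeff_eq_zero_of_degree_lt_ordZero ?_
      rw [ho', map_add, hrdeg]
      exact_mod_cast (by omega : 2 + (m.update κ (m.degree - 4)).degree < 6)
  · -- `m̃ o ≥ 4`: then `m̃ κ = 0`, `|m̃| = 4`, and the parent coefficient vanishes by straightness directly
    have hκo' := degree_eq_apply_add_apply_add_degIn hκo m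
    exact hstraight m (by omega) hne

end Legal

/-! ## 4. FLAG reading: isolation along a boundary axis -/

/-- **FLAG READING** (K24b-F3): an ISOLATED `5`-fold point whose boundary has weight `1` at the letter `l` and
total weight `2` carries a monomial `x^{r + m̃}` with `|m̃| ≤ m̃_l + 3` — for `l = λ` and
`m̃ = (a+1)e_λ + (b+1)e_μ + e·e_u + (3−c)e_f` this is `b + e + 1 ≤ c`, the game's λ-FLAG `hflagL` (and `l = μ` gives
`hflagM`).  Isolation forbids the `l`-axis to be `5`-fold (p-5's `ordAlong_erase_lt_of_isIsolated`).  The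
`l`-exponent of the witness is NOT bounded by this lemma. [OURS] [cite: HauserPerlega2019PRIMS, §2 (permissible
blowups)] -/
theorem cInf_flag_reading {l : Fin 4} {s : State K} (hiso : IsIsolated 5 s.F)
    (hdiv : ∀ e ∈ s.F.support, s.r ≤ e) (hrl : s.r l = 1) (hrdeg : s.r.degree = 2) :
    ∃ m : Fin 4 →₀ ℕ, coeff (s.r + m) s.F ≠ 0 ∧ m.degree ≤ m l + 3 := by
  obtain ⟨E, hE, hdegE⟩ := exists_degIn_lt_of_ordAlong_lt (ordAlong_erase_lt_of_isIsolated hiso l)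
  obtain ⟨m, rfl⟩ : ∃ m, E = s.r + m := ⟨E - s.r, (add_tsub_cancel_of_le (hdiv E hE)).symm⟩
  refine ⟨m, MvPolynomial.mem_support_iff.mp hE, ?_⟩
  have h := degIn_erase_add_apply l (s.r + m)
  rw [Finsupp.add_apply, hrl, map_add, hrdeg] at h
  omega

end ResCone

end Summit.ResolutionOfSingularities.ResolutionOfSingularities.Theorems.PIDim4

end
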